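import Literature.MathematicalPhysics.QuantumFieldTheory.Balaban1983to89.Node00.TorusCoverGaugeAveragesZdRestr
import Literature.MathematicalPhysics.QuantumFieldTheory.Balaban1983to89.B8BlockConstantLiftStabilityRec

/-!
# NODE 00 — THE TORUS→`ℤᵈ` TWIN, FILE 40c: THE φ-ROW DICTIONARY — the NORM row «`‖(R̄ʲg)(y) − 1‖ ≤ ψ`» of N07's `NrmSymPhiOfRecord` (the φ-b₂ edition of the (81)∕(1.29)
# normalisation, director-ym №311a∕№312a case (β)) read under the cover in the transcription's GUARDED currency `uavgZG L δ_N 1` EXACTLY (no hypothesis), and in the UNGUARDED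
# currency `uavgZ L 1 = Rbar (zdBlockingZ d L) (bgTZ L 1)` of the cross-term bound ((B′-5)′, `B8ExpMeanLogCrossTermTowerRec`) under a LOCAL smallness of the (78) families UNDER THE CELL only

Cell `pub-ymgap`, width seat `pub-ymgap-dag-n07-w3` generation 13 (torus push-down lineage; junction side of the K0 road, pen (j-ii) of plan g93's WORD A3⁵ = ρ3 «φ-form» as
amended by №312a (β)).  `--kind proof --supports stmt-QuantumFields-20541` (K0⁷; count-neutral; THEOREMS ONLY, 0 `def`).  CONSUMED BY NAME, nothing modified: FILE 40
`Node00.TorusCoverGaugeAveragesZd` (`uavgZG_one_coverLift_eq_gaugeAvgIter`, `uavgZG_one_succ`, `uavgZ_one_succ`), FILE 40b `Node00.TorusCoverGaugeAveragesZdRestr`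
(`Rbar_zdBlockingZ_one_eq_uavgZ`), dag-n05-e's `B7SectCDGaugeAveragesRec` (`SexpZ savgZ uavgZ`) ∕ `B7SectEFLinearisationRec` §10 (`savgZG uavgZG savgZG_eq_savgZ_of_small`) ∕
`B8BlockConstantLiftStabilityRec` (`underZ_add`), n05-d's `B8Eq119TwistedAxialRec` (`UnderZ underZ_zero_iff underZ_one_block bgTZ_one`).
[3] = [Balaban1985Averaging]; [6] = [Balaban1985RegularSpaces]; [I] = [Balaban1987RG1].

WHY.  The premise of record `HThm4RecSym152Phi F N Mc ρ κ a₀ ψ` (dag-n07-e, (c-ii)′) carries row 9′ `NrmSymPhiOfRecord … ψ … u A`: on every cell `y ∈ Λ′_{j′}(D″)`,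
«`‖((gaugeAvgIter (loopAvgBlockOp expMeanLogSU) (h̄·w·u⁻¹) j′ y : SU N) : M_N(ℂ)) − 1‖ ≤ ψ`» — NODE 00's flat gauge-function average on the TORUS.  The (B′) road delivers the
defect bound in the transcription on `ℤᵈ`: the cross-term tower bound `B8ExpMeanLogCrossTermTowerRec.rbar_one_mul_sub_mul_le_tower` speaks `Rbar (zdBlockingZ d L) (bgTZ L 1) =
uavgZ L 1` (UNGUARDED, [3] (78)–(80) as series), while FILE 40's hypothesis-free dictionary row is for the GUARDED `uavgZG L δ_N 1` (NODE 00's inner operation is guarded).  FILE 40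
§4 releases the guard under a GLOBAL smallness `hs` (every (78) family of every `R̄^{j′}g` on the whole torus) — not dischargeable from Landau rows, which hold on the window only
(dag-n07-e I.30492).  THIS FILE: (§1) the guard is released LOCALLY — the two towers agree at every site UNDER a cell `y` down to depth `j`, given smallness of the unguarded (78)
families under `y` ONLY (exactly the domain the (B′-5)′ oscillation letters `p_i`, `q_i` live on); (§2) the norm row transfers between the two typings EXACTLY (FILE 40 §5 + `coe_ιSU`);
(§3) hence a defect bound proved in the cross-term currency under a cell reads as the torus row at the covered cell.

WHAT IS PROVED (kernel; generic complete normed `ℂ`-algebra `𝔸` in §1, `SU(N)` under `ιSU` in §2–§3; NO estimate — bookkeeping between typings).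
§1 `savgZG_congr` (the guarded (78) depends on `g` only through the centre and the block values), `underZ_smul_add_offZ` (block points of a site under `y` are under `y`, one level
   deeper), ★★ `uavgZG_one_eq_uavgZ_one_under_of_small` (LOCAL GUARD RELEASE: `uavgZG L δ 1 u i z = uavgZ L 1 u i z` for every `i ≤ j` and every `z` under `y` at depth `j − i`,
   given `‖(R̄₀ⁱu(L·z))⁻¹·R̄₀ⁱu(L·z + offZ r) − 1‖ < δ` for `i < j`, `z` under `y` at depth `j − (i+1)`), `…_at` (the cell itself: `i = j`, `z = y`).
§2 ★★★ `norm_coe_gaugeAvgIter_sub_one_eq` (top-anchored, ALL `j ≤ k ≤ m + K`, NO hypothesis: `‖(R̄ʲg)(π_j(w + c_{k−j}·𝟙)) − 1‖ = ‖uavgZG L δ_N 1 (ι∘g∘π∘(·+c_k·𝟙)) j w − 1‖` in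
   `M_N(ℂ)`), ★★ `norm_coe_gaugeAvgIter_sub_one_le_iff` (the φ-row transfers exactly between the two typings).
§3 ★★ `uavgZ_one_coverLift_eq_gaugeAvgIter_under_of_small` (the UNGUARDED identification at ONE cell under LOCAL smallness), ★★★ `norm_coe_gaugeAvgIter_sub_one_le_of_rbar_under`
   (a bound «`‖Rbar (zdBlockingZ d L) (bgTZ L 1) j (↑∘lift g) w − 1‖ ≤ ψ`» in (B′-5)′'s currency, with the local smallness under `w`, IS the torus row «`‖(R̄ʲg)(π_j(w + …)) − 1‖ ≤ ψ`»).
§4 (v1.1) ★★ `uavgZG_one_congr_under` ∕ `…_congr_at` (LOCALITY of the guarded tower under a cell: fields agreeing under `y` at depth `j` have equal towers there), `savgZG_const_one`,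
   `uavgZG_one_const_one`, ★★ `uavgZG_one_eq_one_at_of_eq_one_under` (a field `= 1` under the cell has guarded average `1` at the cell) — the two rows the junction's LEVEL-0 GLUING of the
   delivered gauge (`u := h̄·w` off print's `□₀`; `Domains.Om_zero := T` puts `Λ′₀(D″)`-cells off the window) uses.
§5 (v1.2, file §4) `uavgZ_one_eq_one_of_restr129Z` ((1.29) `Restr129Z L k Λ 1 u` at a cell `y ∈ Λ_j` IS `uavgZ L 1 u j y = 1` — the cell lemma's `hu1` binder for the crown's `u₀`).
§6 (v1.3) ★★ `uavgZ_one_congr_under` ∕ `…_congr_at` (LOCALITY of the UNGUARDED flat tower `uavgZ L 1` under a cell — twin of §4).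
NOT HERE: the defect bound itself (the junction's `p_i`∕`q_i`∕schedule — sibling files), the cells' window dictionary (the Summits-side consumer `…N07NrmSymPhiOfCoverRow`), general
backgrounds `U₀ ≠ 1`.
HONEST FRAMING: count-neutral helper; bookkeeping — nothing of [3]∕[6]∕[I] asserted or discharged; `HThm4RecSym152Phi` ∕ `HThm4Rec*` UNDISCHARGED (CONDITIONAL premises); N07 ∕ N05
NOT discharged; K0⁷ ∕ K1⁹ NOT closed; counts unmoved (typed 28∕28 · discharged 8∕28); one finite 𝕋⁴ programme at fixed ε — R4 closes the conditional finite-𝕋⁴ rung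
`BalabanLadder.UV` only; the YM mass gap (Clay) is NOT proved by any of this; nothing continuum ∕ ℝ⁴ ∕ OS.  No `def`, no `sorry`, no `instance`, no `notation`.

References: [3] (78)–(81) p. 30; [6] (1.29) p. 81, (1.19) p. 79; [I] (0.1) p. 251, (0.3)–(0.4) pp. 252–253, (0.11) p. 253.
-/

set_option autoImplicit false

noncomputable section

open scoped BigOperators Matrix.Norms.L2Operator

namespace Literature.MathematicalPhysics.QuantumFieldTheory.Balaban1983to89.Node00

open B7Prop1Explicit renaming Site → SiteZ
open B7Prop1Explicit (expUnit)
open B7Eq78Linearization (Rbar)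
open B7SectCDGaugeAveragesRec (SexpZ savgZ uavgZ)
open B7SectEFLinearisationRec (zdBlockingZ bgTZ savgZG uavgZG savgZG_eq_savgZ_of_small)
open BlockAveragingZd (offZ ctrShift)
open B8Eq119TwistedAxialRec (UnderZ underZ_zero_iff underZ_one_block bgTZ_one)
open B8BlockConstantLiftStabilityRec (underZ_add)
open B15Eq112TorusCover (cover)
open B14DomainGeom (Pt)
open ExpMeanLog (expMeanLogSU deltaSU)

/-! ## §1  LOCAL guard release on `ℤᵈ`: under a cell, the guarded and the unguarded (79)–(80) towers agree when the unguarded (78) families there are small -/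

section Zd

variable {d : ℕ} (L : ℕ) {𝔸 : Type*} [NormedRing 𝔸] [NormedAlgebra ℂ 𝔸] [CompleteSpace 𝔸]

/-- The GUARDED site average (78) depends on `g` only through `g(y)` and the block values `g(y + offZ L r)` (guard and exponent read the same family).
[cite: Balaban1985Averaging, (78) p.30; Balaban1987RG1, (0.4) p.253] -/
theorem savgZG_congr (δ : ℝ) {g g' : SiteZ d → 𝔸ˣ} {y : SiteZ d} (h0 : g y = g' y) (h : ∀ r : Fin d → Fin L, g (y + offZ L r) = g' (y + offZ L r)) :
    savgZG L δ g y = savgZG L δ g' y := by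
  classical
  unfold savgZG
  have hS : SexpZ L g y = SexpZ L g' y := by
    unfold SexpZ
    simp only [h0, h]
  simp only [h0, h, hS]

/-- The block points `L·z + offZ L r` of a site `z` under `y` at depth `m` are under `y` at depth `m + 1` (odd `L`).
[cite: Balaban1985RegularSpaces, (1.19) p.79 («x_n ∈ B(x_{n+1})»); Balaban1987RG1, (0.3) p.252] -/
theorem underZ_smul_add_offZ {L : ℕ} (hL : Odd L) {m : ℕ} {y z : SiteZ d} (hz : UnderZ L m y z) (r : Fin d → Fin L) :
    UnderZ L (m + 1) y ((L : ℤ) • z + offZ L r) := by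
  obtain ⟨s, hs⟩ := hL
  exact underZ_add ⟨s, hs⟩ hz (underZ_one_block (by omega : L = 2 * s + 1) z r)

/-- ★★ **LOCAL GUARD RELEASE** ([I] (0.4)'s guarded inner operation vs [3] (78)–(80) as series, flat background, odd `L`): fix a cell `y` of level `j` and a gauge function `u`.  If for
every `i < j` and every site `z` under `y` at depth `j − (i+1)` the UNGUARDED (78) family of the `i`-th average at the centre `L·z` is inside the guard,
`‖(R̄₀ⁱu(L·z))⁻¹·R̄₀ⁱu(L·z + offZ L r) − 1‖ < δ`, then the guarded tower `uavgZG L δ 1 u` and the unguarded tower `uavgZ L 1 u` AGREE at every `i ≤ j` and every site under `y` at depth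
`j − i` (induction up the tower: the (78) family at `L·z` consists of sites under `y` one level deeper, where the two towers already agree, and there the guard is released by
`savgZG_eq_savgZ_of_small`).  The smallness is asked UNDER THE CELL ONLY — the domain of the (B′-5)′ oscillation letters. [cite: Balaban1985Averaging, (78)–(80) p.30; Balaban1987RG1, (0.3)–(0.4) pp.252–253; Balaban1985RegularSpaces, (1.19) p.79] -/
theorem uavgZG_one_eq_uavgZ_one_under_of_small {L : ℕ} (hL : Odd L) (δ : ℝ) (u : SiteZ d → 𝔸ˣ) (j : ℕ) (y : SiteZ d)
    (hs : ∀ i, i < j → ∀ z, UnderZ L (j - (i + 1)) y z → ∀ r : Fin d → Fin L,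
      ‖((((uavgZ L (1 : SiteZ d → Fin d → 𝔸ˣ) u i ((L : ℤ) • z))⁻¹ *
          uavgZ L (1 : SiteZ d → Fin d → 𝔸ˣ) u i ((L : ℤ) • z + offZ L r) : 𝔸ˣ)) : 𝔸) - 1‖ < δ) :
    ∀ i, i ≤ j → ∀ z, UnderZ L (j - i) y z →
      uavgZG L δ (1 : SiteZ d → Fin d → 𝔸ˣ) u i z = uavgZ L (1 : SiteZ d → Fin d → 𝔸ˣ) u i z := by
  intro i
  induction i with
  | zero => intro _ z _; rfl
  | succ i IH =>
    intro hi z hz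
    have hij : i < j := by omega
    -- the block points of `L·z` are under `y` at depth `j − i`, where the two towers agree
    have hdepth : j - (i + 1) + 1 = j - i := by omega
    have hblock : ∀ r : Fin d → Fin L,
        uavgZG L δ (1 : SiteZ d → Fin d → 𝔸ˣ) u i ((L : ℤ) • z + offZ L r) = uavgZ L (1 : SiteZ d → Fin d → 𝔸ˣ) u i ((L : ℤ) • z + offZ L r) := by
      intro r
      have h := underZ_smul_add_offZ hL hz r
      rw [hdepth] at h
      exact IH hij.le _ h
    have hctr : uavgZG L δ (1 : SiteZ d → Fin d → 𝔸ˣ) u i ((L : ℤ) • z) = uavgZ L (1 : SiteZ d → Fin d → 𝔸ˣ) u i ((L : ℤ) • z) := by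
      obtain ⟨s, hs'⟩ := hL
      have h := underZ_add ⟨s, hs'⟩ hz (B8Eq119TwistedAxialRec.underZ_one_centre L z)
      rw [hdepth] at h
      exact IH hij.le _ h
    rw [uavgZG_one_succ, uavgZ_one_succ, savgZG_congr L δ hctr hblock]
    exact savgZG_eq_savgZ_of_small L (hs i hij z hz)

/-- The cell itself (`i = j`, depth `0`): `uavgZG L δ 1 u j y = uavgZ L 1 u j y` under the local smallness. [cite: Balaban1985Averaging, (78)–(80) p.30; Balaban1987RG1, (0.4) p.253] -/
theorem uavgZG_one_eq_uavgZ_one_at_of_small {L : ℕ} (hL : Odd L) (δ : ℝ) (u : SiteZ d → 𝔸ˣ) (j : ℕ) (y : SiteZ d)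
    (hs : ∀ i, i < j → ∀ z, UnderZ L (j - (i + 1)) y z → ∀ r : Fin d → Fin L,
      ‖((((uavgZ L (1 : SiteZ d → Fin d → 𝔸ˣ) u i ((L : ℤ) • z))⁻¹ *
          uavgZ L (1 : SiteZ d → Fin d → 𝔸ˣ) u i ((L : ℤ) • z + offZ L r) : 𝔸ˣ)) : 𝔸) - 1‖ < δ) :
    uavgZG L δ (1 : SiteZ d → Fin d → 𝔸ˣ) u j y = uavgZ L (1 : SiteZ d → Fin d → 𝔸ˣ) u j y :=
  uavgZG_one_eq_uavgZ_one_under_of_small hL δ u j y hs j le_rfl y (by rw [Nat.sub_self]; exact (underZ_zero_iff L y y).2 rfl)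

/-- [6] (1.29)'s generic `Rbar (zdBlockingZ d L) (bgTZ L 1)` read pointwise in `uavgZ L 1` (n05-d's `rbar_bgTZ_eq_uavgZ`, pointwise form for rewriting).
[cite: Balaban1985RegularSpaces, (1.29) p.81; Balaban1985Averaging, (79)–(80) p.30] -/
theorem rbar_bgTZ_one_apply (u : SiteZ d → 𝔸ˣ) (j : ℕ) (y : SiteZ d) :
    Rbar (zdBlockingZ d L) (bgTZ L (1 : SiteZ d → Fin d → 𝔸ˣ)) j (fun x => ((u x : 𝔸ˣ) : 𝔸)) y = ((uavgZ L (1 : SiteZ d → Fin d → 𝔸ˣ) u j y : 𝔸ˣ) : 𝔸) := by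
  rw [bgTZ_one]
  exact congr_fun (Rbar_zdBlockingZ_one_eq_uavgZ L u j) y

end Zd

/-! ## §2  Under the cover: the φ-row «`‖R̄ʲg(y) − 1‖ ≤ ψ`» in the two typings — EXACT, no hypothesis -/

section Cover

variable {P : Params} (N : ℕ) [NeZero N]

/-- ★★★ **THE φ-ROW DICTIONARY, GUARDED CURRENCY, NO HYPOTHESIS** (top-anchored, `j ≤ k ≤ m + K`): the defect of NODE 00's `j`-fold flat gauge-function average at the covered cell,
`‖((R̄ʲg)(π_j(w + (L^{k−j}−1)∕2·𝟙)) : M_N(ℂ)) − 1‖` — the quantity row 9′ of N07's `NrmSymPhiOfRecord` bounds by `ψ` — EQUALS the defect of the transcription's guarded average of the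
lift, `‖uavgZG L δ_N 1 (ι∘g∘π∘(·+(Lᵏ−1)∕2·𝟙)) j w − 1‖` (FILE 40 §5 + `coe_ιSU`). [cite: Balaban1985Averaging, (78)–(81) p.30; Balaban1987RG1, (0.3)–(0.4) pp.252–253, (0.11) p.253] -/
theorem norm_coe_gaugeAvgIter_sub_one_eq {k : ℕ} (hk : k ≤ P.m + P.K) (g : GaugeTransf P 0 (SU N)) {j : ℕ} (hj : j ≤ k) (w : Pt P.d) :
    ‖((gaugeAvgIter (loopAvgBlockOp expMeanLogSU) g j (coverAt P j (w + fun _ => ((ctrShift P.L (k - j) : ℕ) : ℤ))) : SU N) : Matrix (Fin N) (Fin N) ℂ) - 1‖ =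
      ‖((uavgZG P.L (deltaSU (Fin N)) (1 : Pt P.d → Fin P.d → (MatA N)ˣ)
          (fun x => ιSU N (g (cover P (x + fun _ => ((ctrShift P.L k : ℕ) : ℤ))))) j w : (MatA N)ˣ) : MatA N) - 1‖ := by
  rw [uavgZG_one_coverLift_eq_gaugeAvgIter N hk g j hj]
  rfl

/-- ★★ **THE φ-ROW TRANSFERS EXACTLY**: «`‖uavgZG L δ_N 1 (lift g) j w − 1‖ ≤ ψ`» ↔ «`‖(R̄ʲg)(π_j(w + …)) − 1‖ ≤ ψ`» — the `= 1` row of FILE 40 (`uavgZG_one_coverLift_eq_one_iff`) relaxed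
to the displayed defect of the φ-b₂ edition. [cite: Balaban1985Averaging, (81) p.30; Balaban1985RegularSpaces, (1.29) p.81; Balaban1987RG1, (0.4) p.253] -/
theorem norm_coe_gaugeAvgIter_sub_one_le_iff {k : ℕ} (hk : k ≤ P.m + P.K) (g : GaugeTransf P 0 (SU N)) {j : ℕ} (hj : j ≤ k) (w : Pt P.d) (ψ : ℝ) :
    ‖((uavgZG P.L (deltaSU (Fin N)) (1 : Pt P.d → Fin P.d → (MatA N)ˣ)
          (fun x => ιSU N (g (cover P (x + fun _ => ((ctrShift P.L k : ℕ) : ℤ))))) j w : (MatA N)ˣ) : MatA N) - 1‖ ≤ ψ ↔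
      ‖((gaugeAvgIter (loopAvgBlockOp expMeanLogSU) g j (coverAt P j (w + fun _ => ((ctrShift P.L (k - j) : ℕ) : ℤ))) : SU N) : Matrix (Fin N) (Fin N) ℂ) - 1‖ ≤ ψ := by
  rw [norm_coe_gaugeAvgIter_sub_one_eq N hk g hj w]

/-! ## §3  The UNGUARDED currency of the cross-term bound, under LOCAL smallness under the cell -/

/-- ★★ **THE UNGUARDED IDENTIFICATION AT ONE CELL UNDER LOCAL SMALLNESS** (top-anchored, `j ≤ k ≤ m + K`): if the unguarded (78) families of the lift's averages are inside `δ_N` at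
every site under `w` (levels `< j`), then `uavgZ L 1 (ι∘g∘π∘(·+(Lᵏ−1)∕2·𝟙)) j w = ι((R̄ʲg)(π_j(w + (L^{k−j}−1)∕2·𝟙)))` — FILE 40 §4's row with its GLOBAL `hs` replaced by smallness
under the one cell. [cite: Balaban1985Averaging, (78)–(81) p.30; Balaban1987RG1, (0.3)–(0.4) pp.252–253] -/
theorem uavgZ_one_coverLift_eq_gaugeAvgIter_under_of_small {k : ℕ} (hk : k ≤ P.m + P.K) (g : GaugeTransf P 0 (SU N)) {j : ℕ} (hj : j ≤ k) (w : Pt P.d)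
    (hs : ∀ i, i < j → ∀ z, UnderZ P.L (j - (i + 1)) w z → ∀ r : Fin P.d → Fin P.L,
      ‖((((uavgZ P.L (1 : Pt P.d → Fin P.d → (MatA N)ˣ) (fun x => ιSU N (g (cover P (x + fun _ => ((ctrShift P.L k : ℕ) : ℤ))))) i ((P.L : ℤ) • z))⁻¹ *
          uavgZ P.L (1 : Pt P.d → Fin P.d → (MatA N)ˣ) (fun x => ιSU N (g (cover P (x + fun _ => ((ctrShift P.L k : ℕ) : ℤ))))) i ((P.L : ℤ) • z + offZ P.L r) :
            (MatA N)ˣ)) : MatA N) - 1‖ < deltaSU (Fin N)) :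
    uavgZ P.L (1 : Pt P.d → Fin P.d → (MatA N)ˣ) (fun x => ιSU N (g (cover P (x + fun _ => ((ctrShift P.L k : ℕ) : ℤ))))) j w =
      ιSU N (gaugeAvgIter (loopAvgBlockOp expMeanLogSU) g j (coverAt P j (w + fun _ => ((ctrShift P.L (k - j) : ℕ) : ℤ)))) := by
  rw [← uavgZG_one_eq_uavgZ_one_at_of_small P.hL.1 (deltaSU (Fin N)) _ j w hs, uavgZG_one_coverLift_eq_gaugeAvgIter N hk g j hj]

/-- ★★★ **A DEFECT BOUND IN THE CROSS-TERM CURRENCY IS THE TORUS ROW** (top-anchored, `j ≤ k ≤ m + K`): with the local smallness under the cell `w`, a bound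
«`‖Rbar (zdBlockingZ d L) (bgTZ L 1) j (↑∘ι∘g∘π∘(·+(Lᵏ−1)∕2·𝟙)) w − 1‖ ≤ ψ`» — the conclusion shape of `B8ExpMeanLogCrossTermTowerRec.rbar_one_mul_sub_mul_le_tower` at `z = w`, `i = j`
once `R̄ʲa(w)·R̄ʲu(w) = 1` — IS row 9′ of `NrmSymPhiOfRecord` at the covered cell: `‖(R̄ʲg)(π_j(w + (L^{k−j}−1)∕2·𝟙)) − 1‖ ≤ ψ`.
[cite: Balaban1985Averaging, (78)–(81) p.30; Balaban1985RegularSpaces, (1.29) p.81; Balaban1987RG1, (0.3)–(0.4) pp.252–253, (0.11) p.253] -/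
theorem norm_coe_gaugeAvgIter_sub_one_le_of_rbar_under {k : ℕ} (hk : k ≤ P.m + P.K) (g : GaugeTransf P 0 (SU N)) {j : ℕ} (hj : j ≤ k) (w : Pt P.d) {ψ : ℝ}
    (hs : ∀ i, i < j → ∀ z, UnderZ P.L (j - (i + 1)) w z → ∀ r : Fin P.d → Fin P.L,
      ‖((((uavgZ P.L (1 : Pt P.d → Fin P.d → (MatA N)ˣ) (fun x => ιSU N (g (cover P (x + fun _ => ((ctrShift P.L k : ℕ) : ℤ))))) i ((P.L : ℤ) • z))⁻¹ *
          uavgZ P.L (1 : Pt P.d → Fin P.d → (MatA N)ˣ) (fun x => ιSU N (g (cover P (x + fun _ => ((ctrShift P.L k : ℕ) : ℤ))))) i ((P.L : ℤ) • z + offZ P.L r) :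
            (MatA N)ˣ)) : MatA N) - 1‖ < deltaSU (Fin N))
    (hψ : ‖Rbar (zdBlockingZ P.d P.L) (bgTZ P.L (1 : Pt P.d → Fin P.d → (MatA N)ˣ)) j
        (fun x => ((ιSU N (g (cover P (x + fun _ => ((ctrShift P.L k : ℕ) : ℤ)))) : (MatA N)ˣ) : MatA N)) w - 1‖ ≤ ψ) :
    ‖((gaugeAvgIter (loopAvgBlockOp expMeanLogSU) g j (coverAt P j (w + fun _ => ((ctrShift P.L (k - j) : ℕ) : ℤ))) : SU N) : Matrix (Fin N) (Fin N) ℂ) - 1‖ ≤ ψ := by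
  rw [rbar_bgTZ_one_apply, uavgZ_one_coverLift_eq_gaugeAvgIter_under_of_small N hk g hj w hs] at hψ
  exact hψ

end Cover

/-! ## §4  (v1.1) LOCALITY of the guarded tower under a cell, and the tower of a field that is `1` under the cell -/

section Locality

variable {d : ℕ} (L : ℕ) {𝔸 : Type*} [NormedRing 𝔸] [NormedAlgebra ℂ 𝔸] [CompleteSpace 𝔸]

/-- ★★ **LOCALITY OF THE GUARDED (79)–(80) TOWER UNDER A CELL** (flat background, odd `L`): if two gauge functions agree at every site under the cell `y` at depth `j`, their guarded
towers agree at every `i ≤ j` and every site under `y` at depth `j − i` (the (78) family at a centre `L·z` consists of sites one level deeper under `y`).  The junction's gluing of the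
delivered gauge off print's `□₀` does not change row 9′ at cells whose towers lie under `□₀`. [cite: Balaban1985Averaging, (78)–(80) p.30; Balaban1987RG1, (0.3)–(0.4) pp.252–253; Balaban1985RegularSpaces, (1.19) p.79] -/
theorem uavgZG_one_congr_under {L : ℕ} (hL : Odd L) (δ : ℝ) {g g' : SiteZ d → 𝔸ˣ} (j : ℕ) (y : SiteZ d)
    (hg : ∀ x, UnderZ L j y x → g x = g' x) :
    ∀ i, i ≤ j → ∀ z, UnderZ L (j - i) y z →
      uavgZG L δ (1 : SiteZ d → Fin d → 𝔸ˣ) g i z = uavgZG L δ (1 : SiteZ d → Fin d → 𝔸ˣ) g' i z := by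
  intro i
  induction i with
  | zero => intro _ z hz; rw [Nat.sub_zero] at hz; exact hg z hz
  | succ i IH =>
    intro hi z hz
    have hij : i < j := by omega
    have hdepth : j - (i + 1) + 1 = j - i := by omega
    have hblock : ∀ r : Fin d → Fin L,
        uavgZG L δ (1 : SiteZ d → Fin d → 𝔸ˣ) g i ((L : ℤ) • z + offZ L r) = uavgZG L δ (1 : SiteZ d → Fin d → 𝔸ˣ) g' i ((L : ℤ) • z + offZ L r) := by
      intro r
      have h := underZ_smul_add_offZ hL hz r
      rw [hdepth] at h
      exact IH hij.le _ h
    have hctr : uavgZG L δ (1 : SiteZ d → Fin d → 𝔸ˣ) g i ((L : ℤ) • z) = uavgZG L δ (1 : SiteZ d → Fin d → 𝔸ˣ) g' i ((L : ℤ) • z) := by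
      obtain ⟨s, hs'⟩ := hL
      have h := underZ_add ⟨s, hs'⟩ hz (B8Eq119TwistedAxialRec.underZ_one_centre L z)
      rw [hdepth] at h
      exact IH hij.le _ h
    rw [uavgZG_one_succ, uavgZG_one_succ, savgZG_congr L δ hctr hblock]

/-- The cell itself: agreement under `y` at depth `j` gives `uavgZG L δ 1 g j y = uavgZG L δ 1 g′ j y`. [cite: Balaban1985Averaging, (78)–(80) p.30; Balaban1987RG1, (0.4) p.253] -/
theorem uavgZG_one_congr_at {L : ℕ} (hL : Odd L) (δ : ℝ) {g g' : SiteZ d → 𝔸ˣ} (j : ℕ) (y : SiteZ d)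
    (hg : ∀ x, UnderZ L j y x → g x = g' x) :
    uavgZG L δ (1 : SiteZ d → Fin d → 𝔸ˣ) g j y = uavgZG L δ (1 : SiteZ d → Fin d → 𝔸ˣ) g' j y :=
  uavgZG_one_congr_under hL δ j y hg j le_rfl y (by rw [Nat.sub_self]; exact (underZ_zero_iff L y y).2 rfl)

/-- The GUARDED site average of the constant function `1` is `1` (exponent `S₁ = Σ L⁻ᵈ·log 1 = 0`; on or off the guard the inner factor is `1`).
[cite: Balaban1985Averaging, (78) p.30, (81) p.30 (bookkeeping)] -/
theorem savgZG_const_one (δ : ℝ) (y : SiteZ d) : savgZG L δ (fun _ : SiteZ d => (1 : 𝔸ˣ)) y = 1 := by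
  classical
  have hS : SexpZ L (fun _ : SiteZ d => (1 : 𝔸ˣ)) y = 0 := by
    unfold SexpZ
    simp [MatrixLog.mlog_one]
  unfold savgZG
  rw [hS]
  split_ifs
  · apply Units.ext
    simp [B7Prop1Explicit.val_expUnit]
  · rw [one_mul]

/-- The GUARDED tower of the constant function `1` is `1` at every level ((81) «`R̄₀1 = 1`», guarded edition). [cite: Balaban1985Averaging, (81) p.30 (bookkeeping)] -/
theorem uavgZG_one_const_one (δ : ℝ) : ∀ (i : ℕ) (z : SiteZ d), uavgZG L δ (1 : SiteZ d → Fin d → 𝔸ˣ) (fun _ : SiteZ d => (1 : 𝔸ˣ)) i z = 1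
  | 0, _ => rfl
  | i + 1, z => by
    rw [uavgZG_one_succ]
    have h : uavgZG L δ (1 : SiteZ d → Fin d → 𝔸ˣ) (fun _ : SiteZ d => (1 : 𝔸ˣ)) i = fun _ => 1 := funext (uavgZG_one_const_one δ i)
    rw [h, savgZG_const_one]

/-- ★★ **A FIELD EQUAL TO `1` UNDER THE CELL HAS GUARDED AVERAGE `1` AT THE CELL** (odd `L`): the junction's row 9′ at the level-`0`∕off-`□₀` cells where the glued gauge makes
`g = h̄·w·u⁻¹ = 1` pointwise, and at any cell whose whole tower sees `g = 1`. [cite: Balaban1985Averaging, (81) p.30; Balaban1987RG1, (0.4) p.253] -/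
theorem uavgZG_one_eq_one_at_of_eq_one_under {L : ℕ} (hL : Odd L) (δ : ℝ) {g : SiteZ d → 𝔸ˣ} (j : ℕ) (y : SiteZ d)
    (hg : ∀ x, UnderZ L j y x → g x = 1) : uavgZG L δ (1 : SiteZ d → Fin d → 𝔸ˣ) g j y = 1 := by
  rw [uavgZG_one_congr_at hL δ (g' := fun _ => (1 : 𝔸ˣ)) j y hg, uavgZG_one_const_one]

end Locality

/-! ## §5  v1.2 APPEND (2026-08-30, g13 session 3): (1.29) read as the cell lemma's `hu1` binder -/

section Restr

variable {d : ℕ} {𝔸 : Type*} [NormedRing 𝔸] [NormedAlgebra ℂ 𝔸] [CompleteSpace 𝔸]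

/-- **(1.29) ⇒ `R̄₀ʲu(y) = 1` IN `uavgZ L 1` CURRENCY** (flat background): the record's `Restr129Z L k Λ 1 u` gives, at every cell `y ∈ Λ_j` (`j ≤ k`), the unit-valued identity
`uavgZ L 1 u j y = 1` — VERBATIM the `hu1` binder of ✓p755807 `B8ExpMeanLogCrossTermCellRec.norm_uavgZ_one_mul_inv_mul_sub_one_le_of_pointwise` (and of this seat's (σ2) capstones) for the
crown's Theorem-4 gauge `u₀`. [cite: Balaban1985RegularSpaces, (1.29) p.81; Balaban1985Averaging, (79)–(80) p.30] -/
theorem uavgZ_one_eq_one_of_restr129Z {L k : ℕ} {Λ : ℕ → Set (SiteZ d)} {u : SiteZ d → 𝔸ˣ} (h : B8Eq119TwistedAxialRec.Restr129Z L k Λ (1 : SiteZ d → Fin d → 𝔸ˣ) u)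
    {j : ℕ} (hj : j ≤ k) {y : SiteZ d} (hy : y ∈ Λ j) : uavgZ L (1 : SiteZ d → Fin d → 𝔸ˣ) u j y = 1 :=
  Units.val_eq_one.mp (by rw [← rbar_bgTZ_one_apply]; exact h j hj y hy)

end Restr

/-! ## §6  v1.3 APPEND (2026-08-30, g13 session 3): LOCALITY of the UNGUARDED flat tower under a cell -/

section LocalityUnguarded

variable {d : ℕ} {𝔸 : Type*} [NormedRing 𝔸] [NormedAlgebra ℂ 𝔸] [CompleteSpace 𝔸]

/-- ★★ **LOCALITY OF THE UNGUARDED (79)–(80) TOWER UNDER A CELL** (flat background, odd `L`): if two gauge functions agree at every site under the cell `y` at depth `j`, their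
UNGUARDED towers `uavgZ L 1` agree at every `i ≤ j` and every site under `y` at depth `j − i` — the twin of §4's `uavgZG_one_congr_under` (same proof over `uavgZ_one_succ` +
`savgZ_congr`); the junction rewrites `uavgZ L 1 (lift(h̄·w·u′⁻¹)) j′ y = uavgZ L 1 (τ·h⁻¹·u₀) j′ y` from the pointwise glue identity under the cell.
[cite: Balaban1985Averaging, (78)–(80) p.30; Balaban1987RG1, (0.3)–(0.4) pp.252–253; Balaban1985RegularSpaces, (1.19) p.79] -/
theorem uavgZ_one_congr_under {L : ℕ} (hL : Odd L) {g g' : SiteZ d → 𝔸ˣ} (j : ℕ) (y : SiteZ d)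
    (hg : ∀ x, UnderZ L j y x → g x = g' x) :
    ∀ i, i ≤ j → ∀ z, UnderZ L (j - i) y z →
      uavgZ L (1 : SiteZ d → Fin d → 𝔸ˣ) g i z = uavgZ L (1 : SiteZ d → Fin d → 𝔸ˣ) g' i z := by
  intro i
  induction i with
  | zero => intro _ z hz; rw [Nat.sub_zero] at hz; exact hg z hz
  | succ i IH =>
    intro hi z hz
    have hij : i < j := by omega
    have hdepth : j - (i + 1) + 1 = j - i := by omega
    have hblock : ∀ r : Fin d → Fin L,
        uavgZ L (1 : SiteZ d → Fin d → 𝔸ˣ) g i ((L : ℤ) • z + offZ L r) = uavgZ L (1 : SiteZ d → Fin d → 𝔸ˣ) g' i ((L : ℤ) • z + offZ L r) := by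
      intro r
      have h := underZ_smul_add_offZ hL hz r
      rw [hdepth] at h
      exact IH hij.le _ h
    have hctr : uavgZ L (1 : SiteZ d → Fin d → 𝔸ˣ) g i ((L : ℤ) • z) = uavgZ L (1 : SiteZ d → Fin d → 𝔸ˣ) g' i ((L : ℤ) • z) := by
      obtain ⟨s, hs'⟩ := hL
      have h := underZ_add ⟨s, hs'⟩ hz (B8Eq119TwistedAxialRec.underZ_one_centre L z)
      rw [hdepth] at h
      exact IH hij.le _ h
    have hS : SexpZ L (uavgZ L (1 : SiteZ d → Fin d → 𝔸ˣ) g i) ((L : ℤ) • z) = SexpZ L (uavgZ L (1 : SiteZ d → Fin d → 𝔸ˣ) g' i) ((L : ℤ) • z) := by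
      unfold SexpZ
      simp only [hctr, hblock]
    rw [uavgZ_one_succ, uavgZ_one_succ]
    unfold savgZ
    rw [hS, hctr]

/-- The cell itself: agreement under `y` at depth `j` gives `uavgZ L 1 g j y = uavgZ L 1 g′ j y`. [cite: Balaban1985Averaging, (78)–(80) p.30; Balaban1987RG1, (0.4) p.253] -/
theorem uavgZ_one_congr_at {L : ℕ} (hL : Odd L) {g g' : SiteZ d → 𝔸ˣ} (j : ℕ) (y : SiteZ d)
    (hg : ∀ x, UnderZ L j y x → g x = g' x) :
    uavgZ L (1 : SiteZ d → Fin d → 𝔸ˣ) g j y = uavgZ L (1 : SiteZ d → Fin d → 𝔸ˣ) g' j y :=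
  uavgZ_one_congr_under hL j y hg j le_rfl y (by rw [Nat.sub_self]; exact (underZ_zero_iff L y y).2 rfl)

end LocalityUnguarded

end Literature.MathematicalPhysics.QuantumFieldTheory.Balaban1983to89.Node00

end
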